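import Mathlib.NumberTheory.Chebyshev
import Literature.NumberTheory.LFunctions.ZetaFirstZeroCertificate
import Literature.NumberTheory.LFunctions.ZetaRealAxis
import Literature.NumberTheory.LFunctions.MiscArithmeticRHEquivalents
import Literature.NumberTheory.DiophantineGeometry.NamedHypothesesRHProofs
import HarnessLib

/-!
# Route LittlewoodRadar · crux `PintzLocalisationPos` (stmt-RiemannHypothesis-23714) · LINE `pintz-kernel` · stub `stub_reflect`

The registered stub `stub_reflect` of the skeleton `Lines/pintz-kernel.lean` (route lead
rlead-rh-LittlewoodRadar g0): **reduction of the localisation statement to zeros in the upper-right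
quarter of the strip.**  If every zero `s'` with `1/2 ≤ Re s' < 1`, `Im s' > 14` localises a large value
`|ψ(x) − x| > 1.41 x^{Re s'}/‖s'‖` in every window `[Y, Y^{10⁴ log(Im s'+5)}]` (`log Y ≥ 10⁴(1+log(Im s'+5))`),
then every zero `s` of the open strip does so with the constant `1.4` and `|Im s|` in place of `Im s'`.

Proof: a strip zero has `|Im s| > 14` (no real zeros in `(0,1)`: `riemannZeta_neg_of_pos_of_lt_one`; none
with `0 < |Im s| ≤ 14`: `riemannZeta_ne_zero_of_im_pos_of_im_le_fourteen` and conjugation).  Put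
`s' = s`, `conj s`, `1 − conj s` or `1 − s` according to the signs of `Re s − 1/2` and `Im s` (zeros by
`riemannZeta_conj_eq_zero`, `riemannZeta_one_sub_eq_zero`); then `Im s' = |Im s|`, `Re s ≤ Re s'` (so
`x^{Re s} ≤ x^{Re s'}` for `x ≥ Y > 1`) and `1.4 ‖s'‖ ≤ 1.41 ‖s‖` (equality in the first two cases; in the
reflected cases `‖s'‖² ≤ 1 + t² ≤ (1.41/1.4)² t²` as `t² > 196`).  Rung currency for the RH-free door
`ThetaRadarDoor`; nothing here bears on the truth of RH.
-/

-- D-0017: `Summit.RiemannHypothesis.RiemannHypothesis.…` duplicates the namespace BY DESIGN (single-problem summit).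
set_option linter.dupNamespace false

noncomputable section

namespace Summit.RiemannHypothesis.RiemannHypothesis.Theorems.LittlewoodRadar

open scoped ComplexConjugate ComplexOrder
open Literature.NumberTheory.LFunctions

/-- A zero of `ζ` in the open critical strip has `|Im s| > 14`. [cite: Edwards1974, §6.6] -/
lemma fourteen_lt_abs_im_of_zero {s : ℂ} (hs : riemannZeta s = 0) (h0 : 0 < s.re) (h1 : s.re < 1) :
    14 < |s.im| := by
  by_contra h
  rw [not_lt] at h
  rcases lt_trichotomy s.im 0 with hneg | hzero | hpos
  · -- the conjugate zero has `0 < Im ≤ 14`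
    have hz := Literature.NumberTheory.DiophantineGeometry.riemannZeta_conj_eq_zero hs
    have habs : |s.im| = -s.im := abs_of_neg hneg
    exact riemannZeta_ne_zero_of_im_pos_of_im_le_fourteen (s := conj s)
      (by rw [Complex.conj_im]; linarith) (by rw [Complex.conj_im]; linarith) hz
  · -- a real zero in `(0, 1)`: impossible, `ζ < 0` there
    have hsr : s = ((s.re : ℝ) : ℂ) := Complex.ext (by simp) (by simp [hzero])
    have hlt := riemannZeta_neg_of_pos_of_lt_one h0 h1
    rw [← hsr, hs] at hlt
    exact lt_irrefl _ hlt
  · have habs : |s.im| = s.im := abs_of_pos hpos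
    exact riemannZeta_ne_zero_of_im_pos_of_im_le_fourteen hpos (by linarith) hs

/-- In the reflected cases: `1.4 ‖s'‖ ≤ 1.41 ‖s‖` when `Re s' = 1 − Re s`, `|Im s'| = |Im s|`,
`0 < Re s < 1`, `|Im s| > 14`. [folklore] -/
lemma norm_reflect_le {s s' : ℂ} (hre : s'.re = 1 - s.re) (him : |s'.im| = |s.im|) (h0 : 0 < s.re)
    (h1 : s.re < 1) (h14 : 14 < |s.im|) : 1.4 * ‖s'‖ ≤ 1.41 * ‖s‖ := by
  have hsq : ∀ z : ℂ, ‖z‖ ^ 2 = z.re ^ 2 + z.im ^ 2 := fun z => by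
    rw [Complex.sq_norm, Complex.normSq_apply]; ring
  have him2 : s'.im ^ 2 = s.im ^ 2 := by
    rw [← sq_abs, him, sq_abs]
  have ht : 196 < s.im ^ 2 := by
    have h14' : (14 : ℝ) ^ 2 < |s.im| ^ 2 := by gcongr
    rw [sq_abs] at h14'; linarith
  have hkey : (1.4 * ‖s'‖) ^ 2 ≤ (1.41 * ‖s‖) ^ 2 := by
    rw [mul_pow, mul_pow, hsq, hsq, hre, him2]
    nlinarith
  exact (pow_le_pow_iff_left₀ (by positivity) (by positivity) two_ne_zero).1 hkey

/-- **Registered stub `stub_reflect` of LINE `pintz-kernel`** (crux `PintzLocalisationPos`,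
stmt-RiemannHypothesis-23714): the upper-right-quarter localisation (constant `1.41`) implies the
localisation for every zero of the open strip (constant `1.4`). [folklore] -/
theorem stub_reflect :
    (∀ s : ℂ, riemannZeta s = 0 → 1 / 2 ≤ s.re → s.re < 1 → 14 < s.im →
      ∀ Y : ℝ, 0 < Y → 10 ^ 4 * (1 + Real.log (s.im + 5)) ≤ Real.log Y →
        ∃ x : ℝ, Y ≤ x ∧ x ≤ Y ^ (10 ^ 4 * Real.log (s.im + 5)) ∧
          1.41 * x ^ s.re / ‖s‖ < |Chebyshev.psi x - x|) →
    ∀ s : ℂ, riemannZeta s = 0 → 0 < s.re → s.re < 1 →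
      ∀ Y : ℝ, 0 < Y → 10 ^ 4 * (1 + Real.log (|s.im| + 5)) ≤ Real.log Y →
        ∃ x : ℝ, Y ≤ x ∧ x ≤ Y ^ (10 ^ 4 * Real.log (|s.im| + 5)) ∧
          1.4 * x ^ s.re / ‖s‖ < |Chebyshev.psi x - x| := by
  intro hUR s hs h0 h1 Y hY hlogY
  have h14 := fourteen_lt_abs_im_of_zero hs h0 h1
  -- `Y > 1`, so every `x ≥ Y` has `x ≥ 1`
  have hlog5 : 0 ≤ Real.log (|s.im| + 5) := Real.log_nonneg (by linarith [abs_nonneg s.im])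
  have hY1 : 1 < Y := by
    have : 0 < Real.log Y := by nlinarith
    exact (Real.log_pos_iff hY.le).1 this
  -- the norm of `s` is positive
  have hspos : 0 < ‖s‖ := lt_of_lt_of_le (by linarith [abs_nonneg s.im]) (Complex.abs_im_le_norm s)
  -- core: a zero `s'` in the upper-right quarter at height `|Im s|` dominating `s`
  have core : ∀ s' : ℂ, riemannZeta s' = 0 → 1 / 2 ≤ s'.re → s'.re < 1 → s'.im = |s.im| →
      s.re ≤ s'.re → 1.4 * ‖s'‖ ≤ 1.41 * ‖s‖ →
      ∃ x : ℝ, Y ≤ x ∧ x ≤ Y ^ (10 ^ 4 * Real.log (|s.im| + 5)) ∧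
        1.4 * x ^ s.re / ‖s‖ < |Chebyshev.psi x - x| := by
    intro s' hz' hre1 hre2 him' hrele hnorm
    have him14 : 14 < s'.im := by rw [him']; exact h14
    obtain ⟨x, hx1, hx2, hx3⟩ := hUR s' hz' hre1 hre2 him14 Y hY (by rw [him']; exact hlogY)
    rw [him'] at hx2
    refine ⟨x, hx1, hx2, lt_of_le_of_lt ?_ hx3⟩
    have hx1' : 1 ≤ x := hY1.le.trans hx1
    have hs'pos : 0 < ‖s'‖ := lt_of_lt_of_le (by linarith) (Complex.im_le_norm s')
    have hpow : x ^ s.re ≤ x ^ s'.re := Real.rpow_le_rpow_of_exponent_le hx1' hrele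
    have hpow0 : 0 ≤ x ^ s.re := Real.rpow_nonneg (by linarith) _
    rw [div_le_div_iff₀ hspos hs'pos]
    calc 1.4 * x ^ s.re * ‖s'‖ = x ^ s.re * (1.4 * ‖s'‖) := by ring
      _ ≤ x ^ s'.re * (1.41 * ‖s‖) := mul_le_mul hpow hnorm (by positivity) (hpow0.trans hpow)
      _ = 1.41 * x ^ s'.re * ‖s‖ := by ring
  -- the four cases
  rcases le_or_gt (1 / 2) s.re with hre | hre
  · rcases le_or_gt 0 s.im with him | him
    · -- `s' = s`
      exact core s hs hre h1 (abs_of_nonneg him).symm le_rfl (by nlinarith [norm_nonneg s])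
    · -- `s' = conj s`
      refine core (conj s) (Literature.NumberTheory.DiophantineGeometry.riemannZeta_conj_eq_zero hs)
        (by rw [Complex.conj_re]; exact hre) (by rw [Complex.conj_re]; exact h1)
        (by rw [Complex.conj_im, abs_of_neg him]) (by rw [Complex.conj_re])
        (by rw [Complex.norm_conj]; nlinarith [norm_nonneg s])
  · rcases le_or_gt 0 s.im with him | him
    · -- `s' = 1 - conj s`
      have hz : riemannZeta (1 - conj s) = 0 :=
        riemannZeta_one_sub_eq_zero (by rw [Complex.conj_re]; exact h0) (by rw [Complex.conj_re]; exact h1)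
          (Literature.NumberTheory.DiophantineGeometry.riemannZeta_conj_eq_zero hs)
      have hre' : (1 - conj s).re = 1 - s.re := by simp
      have him' : (1 - conj s).im = s.im := by simp
      refine core (1 - conj s) hz (by rw [hre']; linarith) (by rw [hre']; linarith)
        (by rw [him', abs_of_nonneg him]) (by rw [hre']; linarith) ?_
      exact norm_reflect_le hre' (by rw [him']) h0 h1 h14
    · -- `s' = 1 - s`
      have hz : riemannZeta (1 - s) = 0 := riemannZeta_one_sub_eq_zero h0 h1 hs
      have hre' : (1 - s).re = 1 - s.re := by simp
      have him' : (1 - s).im = -s.im := by simp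
      refine core (1 - s) hz (by rw [hre']; linarith) (by rw [hre']; linarith)
        (by rw [him', abs_of_neg him]) (by rw [hre']; linarith) ?_
      exact norm_reflect_le hre' (by rw [him', abs_neg]) h0 h1 h14

end Summit.RiemannHypothesis.RiemannHypothesis.Theorems.LittlewoodRadar

end
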